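import Mathlib
import Summits.Ventures.PercRepro.TriangleCapDiagonalLocusPieces

/-!
# PercRepro — THE EQUALITY LOCUS OF THE DIAGONAL AT SECOND ORDER, EVERY ROW `a ≥ 4`: a `K₄⁻`-free graph with
`a (k − a)` edges on `k ≥ 2a + 2` vertices that is not `a`-bipartite attains the second-best value
`Σ_v d(v)² + 2a (k − 2a − 1) = m k` iff it is `K_{a+1,k−a−1}` minus a `(k − 2a − 1)`-star — the family `B2` of
§10bt(c) and nothing else (p3, gen 44; part 197b)

The induction of part 195b tracked at equality (parts 197a): the cap is excluded, the convexity is strict, the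
cross-row deletion is tight only on the boundary with `D − z = K_{a+1,k−a−2}` and the neighbours of `z` on its
`(a + 1)`-side (`diag_cross_eq`), the within-row deletion of a vertex of degree `a` (`diag_within_eq`) has `D − z`
complete bipartite with the neighbours of `z` off the small side, or `D − z` at the second-best value of `k − 1` — by
the locus there `(a + 1)`-bipartite with a star, the neighbours of `z` at `k − a − 2` on its `(a + 1)`-side. In
every case `D` is `(a + 1)`-bipartite, and the equality is then the first-order equality of the cell
`(k, a + 1, k − 2a − 1)`: the missing pairs form a star (`exists_missingStar_of_closed_form_eq`). The census
((10,24): 3,150 = `K_{5,5} − e`; (11,28): 62,370 = `K_{5,6}` minus a `2`-star) is the instance `a = 4`. Axioms: standard.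
-/

namespace PercRepro

namespace TriangleCap

namespace C047

open Finset

universe u

variable {V : Type*} [Fintype V] [DecidableEq V]

/-- The edge counts of `D − z` for a vertex of degree `a` on the diagonal: `m' = a (k − 1 − a)`, and at `k = 2a + 3`
also `m' + 1 = (a + 1)((k − 1) − (a + 1))`. -/
theorem diag_within_edges (a k m m' : ℕ) (hk : 2 * a + 2 ≤ k) (hed : m' + a = m) (hm : m = a * (k - a)) :
    m' = a * (k - 1 - a) ∧ (k = 2 * a + 3 → m' + 1 = (a + 1) * (k - 1 - (a + 1))) := by
  have h := below_cell_edges a 0 0 a k m m' hk (by omega) hed (by omega)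
  refine ⟨by omega, fun hk3 => ?_⟩
  subst hk3
  have e1 : 2 * a + 3 - 1 - a = a + 2 := by omega
  have e2 : 2 * a + 3 - 1 - (a + 1) = a + 1 := by omega
  rw [e1] at h
  rw [e2]
  nlinarith [h]

/-- The base `k = 2a + 2` of the gap case: `D − z` on `2a + 1` vertices with `a (a + 1)` edges at the Mantel
envelope is `a`-bipartite (the first-order locus at `r = 0`). -/
theorem diag_within_base (D : SimpleGraph V) [DecidableRel D.Adj] (hK : K4mFree D) (a : ℕ) (ha : 4 ≤ a) (z : V)
    (hk'' : Fintype.card {v : V // v ≠ z} = 2 * a + 1)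
    (hm' : (del D z).edgeFinset.card = a * (Fintype.card {v : V // v ≠ z} - a))
    (hS'eq : ∑ w : {v : V // v ≠ z}, deg (del D z) w * deg (del D z) w =
      (del D z).edgeFinset.card * Fintype.card {v : V // v ≠ z}) :
    ∃ A' : Finset {v : V // v ≠ z}, A'.card = a ∧ BipSub (del D z) A' := by
  have hK' := k4mFree_del D hK z
  have hm'' : (del D z).edgeFinset.card + a * a + 0 = a * Fintype.card {v : V // v ≠ z} := by
    rw [hm', hk'']
    have e : 2 * a + 1 - a = a + 1 := by omega
    rw [e]
    ring
  obtain ⟨A', -, hA'card, hA', -⟩ := (closed_form_eq_iff (del D z) hK' a 0 (by omega) (by omega) (by omega)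
    hm'').mp (by rw [hS'eq]; simp only [zero_mul, add_zero])
  exact ⟨A', hA'card, hA'⟩

/-- The structure of the gap case for `k ≥ 2a + 3`: `D − z ⊆ K(A'', A''ᶜ)` with `|A''| = a + 1` (the locus at
`k − 1`), the neighbours of `z` at degree `k − a − 2 = a + c` ⇒ they lie on a side of size `a + 1`, so `D` is
`(a + 1)`-bipartite. -/
theorem diag_within_structure (D : SimpleGraph V) [DecidableRel D.Adj] (hK : K4mFree D) (a c : ℕ) (ha : 4 ≤ a)
    (hc : 1 ≤ c) (z : V) (hz : deg D z = a) (hk'' : Fintype.card {v : V // v ≠ z} = 2 * a + 1 + c)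
    (A'' : Finset {v : V // v ≠ z}) (hA''card : A''.card = a + 1) (hA'' : BipSub (del D z) A'')
    (hm2 : c = 1 → (del D z).edgeFinset.card + 1 = (a + 1) * (Fintype.card {v : V // v ≠ z} - (a + 1)))
    (hdeg : ∀ w : {v : V // v ≠ z}, D.Adj w.1 z → deg (del D z) w = a + c) :
    ∃ A : Finset V, A.card = a + 1 ∧ BipSub D A := by
  rcases Nat.lt_or_ge 1 c with hc2 | hc1'
  · -- `k ≥ 2a + 4`: a vertex off `A''` has degree `≤ a + 1 < a + c`
    have hin : ∀ w : {v : V // v ≠ z}, D.Adj w.1 z → w ∈ A'' := by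
      intro w hw
      by_contra hwA
      have h1 := deg_le_card_of_bipSub (del D z) A'' hA'' w hwA
      have h2 := hdeg w hw
      omega
    obtain ⟨B, hBcard, hB⟩ := bipSub_lift D z A'' hA'' hin
    exact ⟨B, by rw [hBcard, hA''card], hB⟩
  · -- `k = 2a + 3`: one missing pair, the neighbours of `z` on one side, both of size `a + 1`
    have hc1'' : c = 1 := by omega
    subst hc1''
    rcases nbhd_one_side_of_bipSub D hK z A'' (a + 1) 1 hA''card hA'' (hm2 rfl) (by omega) with hin | hoff
    · obtain ⟨B, hBcard, hB⟩ := bipSub_lift D z A'' hA'' hin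
      exact ⟨B, by rw [hBcard, hA''card], hB⟩
    · have hA''c : BipSub (del D z) A''ᶜ := bipSub_compl (del D z) A'' hA''
      have hoff' : ∀ w : {v : V // v ≠ z}, D.Adj w.1 z → w ∈ A''ᶜ := fun w hw => mem_compl.mpr (hoff w hw)
      obtain ⟨B, hBcard, hB⟩ := bipSub_lift D z A''ᶜ hA''c hoff'
      refine ⟨B, ?_, hB⟩
      rw [hBcard, card_compl, hA''card, hk'']
      omega

/-- **THE WITHIN-ROW CASE AT EQUALITY:** a vertex `z` of degree `a` on the diagonal cell `(k, a, 0)`, `4 ≤ a`,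
`2a + 2 ≤ k`, every degree `≤ k − a − 1`, `D` not `a`-bipartite, `Σ_v d(v)² + 2a (k − 2a − 1) = m k`, given the
locus at `k − 1` for `D − z` (the induction hypothesis) ⇒ `D` is a spanning subgraph of some `K(A, Aᶜ)`, `|A| = a + 1`. -/
theorem diag_within_eq (D : SimpleGraph V) [DecidableRel D.Adj] (hK : K4mFree D) (a : ℕ) (ha : 4 ≤ a)
    (hk : 2 * a + 2 ≤ Fintype.card V) (hm : D.edgeFinset.card = a * (Fintype.card V - a))
    (hcap : ∀ v, deg D v + a + 1 ≤ Fintype.card V) (z : V) (hz : deg D z = a)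
    (hnb : ¬ ∃ A : Finset V, A.card = a ∧ BipSub D A)
    (heq : ∑ v, deg D v * deg D v + 2 * a * (Fintype.card V - 2 * a - 1) = D.edgeFinset.card * Fintype.card V)
    (hIH : 2 * a + 2 ≤ Fintype.card {v : V // v ≠ z} →
      ¬ (∃ A' : Finset {v : V // v ≠ z}, A'.card = a ∧ BipSub (del D z) A') →
      ∑ w : {v : V // v ≠ z}, deg (del D z) w * deg (del D z) w +
        2 * a * (Fintype.card {v : V // v ≠ z} - 2 * a - 1) =
        (del D z).edgeFinset.card * Fintype.card {v : V // v ≠ z} →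
      ∃ (A'' : Finset {v : V // v ≠ z}) (v : {v : V // v ≠ z}), A''.card = a + 1 ∧ BipSub (del D z) A'' ∧
        MissingStar (del D z) A'' v) :
    ∃ A : Finset V, A.card = a + 1 ∧ BipSub D A := by
  have hK' := k4mFree_del D hK z
  have hcard' := card_del z
  have hedges' := card_edges_del D z
  rw [hz] at hedges'
  obtain ⟨k, hk'⟩ : ∃ k, Fintype.card V = k := ⟨_, rfl⟩
  have hk'' : Fintype.card {v : V // v ≠ z} = k - 1 := by omega
  rw [hk'] at hk hm heq
  obtain ⟨hm1, hm2⟩ := diag_within_edges a k D.edgeFinset.card (del D z).edgeFinset.card hk hedges' hm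
  have hm' : (del D z).edgeFinset.card = a * (Fintype.card {v : V // v ≠ z} - a) := by rw [hk'']; exact hm1
  by_cases hbip : ∃ A' : Finset {v : V // v ≠ z}, A'.card = a ∧ BipSub (del D z) A'
  · -- `D − z = K_{a,k−1−a}`: the neighbours of `z` lie on one side
    obtain ⟨A', hA'card, hA'⟩ := hbip
    rcases nbhd_one_side_of_bipSub D hK z A' a 0 hA'card hA' (by rw [add_zero]; exact hm') (by omega)
      with hin | hoff
    · exfalso
      obtain ⟨B, hBcard, hB⟩ := bipSub_lift D z A' hA' hin
      exact hnb ⟨B, by rw [hBcard, hA'card], hB⟩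
    · obtain ⟨A, hAcard, hA⟩ := bipSub_insert_of_nbhd_off D z A' hA' hoff
      exact ⟨A, by rw [hAcard, hA'card], hA⟩
  · -- the gap case: `D − z` at the second-best value of `k − 1`, the neighbours of `z` at `k − a − 2`
    have hsq := sum_deg_sq_del D z
    have hT := sum_del_nbhd_le D z (Fintype.card V - a - 2) (fun v => by have := hcap v; omega)
    rw [hz] at hsq hT
    rcases diag_second_order_gen (del D z) hK' a ha (by rw [hk'']; omega) hm' with h | hgap
    · exact absurd h hbip
    obtain ⟨T, hTdef⟩ : ∃ T, ∑ w : {v : V // v ≠ z}, (if D.Adj w.1 z then deg (del D z) w else 0) = T := ⟨_, rfl⟩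
    obtain ⟨S', hS'def⟩ : ∃ S', ∑ w : {v : V // v ≠ z}, deg (del D z) w * deg (del D z) w = S' := ⟨_, rfl⟩
    obtain ⟨m', hm'def⟩ : ∃ m', (del D z).edgeFinset.card = m' := ⟨_, rfl⟩
    rw [hTdef, hS'def] at hsq
    rw [hTdef, hk'] at hT
    rw [hS'def, hm'def, hk''] at hgap
    rw [hm'def] at hedges' hm1
    rw [hsq, ← hedges'] at heq
    obtain ⟨c, hc⟩ : ∃ c, k = 2 * a + 2 + c := ⟨k - (2 * a + 2), by omega⟩
    subst hc
    have e1 : 2 * a + 2 + c - 1 - 2 * a - 1 = c := by omega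
    have e2 : 2 * a + 2 + c - 1 = 2 * a + 1 + c := by omega
    have e3 : 2 * a + 2 + c - a - 2 = a + c := by omega
    have e4 : 2 * a + 2 + c - 2 * a - 1 = c + 1 := by omega
    have e5 : 2 * a + 2 + c - 1 - a = a + 1 + c := by omega
    rw [e1, e2] at hgap
    rw [e3] at hT
    rw [e4] at heq
    rw [e5] at hm1
    rw [e2] at hk''
    clear hsq hm hedges' hcard'
    obtain ⟨hS'eq, hTeq'⟩ := diag_within_eq_gap a c m' S' T hm1 hgap hT heq
    have hdeg : ∀ w : {v : V // v ≠ z}, D.Adj w.1 z → deg (del D z) w = a + c :=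
      deg_del_eq_of_sum_eq D z (a + c) (fun v => by have := hcap v; omega) (by rw [hTdef, hTeq', hz])
    clear hT hTdef hTeq' heq hgap hcap
    rcases Nat.eq_zero_or_pos c with hc0 | hc1
    · -- `k = 2a + 2`: `D − z` at the Mantel envelope is `K_{a,a+1}`, contradicting the case
      exfalso
      subst hc0
      simp only [mul_zero, add_zero] at hS'eq hk''
      exact hbip (diag_within_base D hK a ha z hk'' hm' (by rw [hS'def, hm'def, hk'']; exact hS'eq))
    · -- `k ≥ 2a + 3`: the locus at `k − 1`, then the neighbours of `z` on its `(a + 1)`-side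
      have e6 : 2 * a + 1 + c - 2 * a - 1 = c := by omega
      obtain ⟨A'', v, hA''card, hA'', -⟩ := hIH (by rw [hk'']; omega) hbip (by
        rw [hS'def, hm'def, hk'', e6]
        exact hS'eq)
      have e7 : 2 * a + 2 + c - 1 - (a + 1) = 2 * a + 1 + c - (a + 1) := by omega
      exact diag_within_structure D hK a c ha hc1 z hz hk'' A'' hA''card hA'' (fun h1 => by
        rw [hk'', ← e7]; exact hm2 (by omega)) hdeg

/-- The equality on the diagonal cell `(k, a, 0)` read on the other bipartition `(k, a + 1, k − 2a − 1)`: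
`2a (k − 2a − 1) = (k − 2a − 1)(k − 1 − (k − 2a − 1))` for `2a + 2 ≤ k`. -/
theorem diag_other_term (a k : ℕ) (hk : 2 * a + 2 ≤ k) :
    2 * a * (k - 2 * a - 1) = (k - 2 * a - 1) * (k - 1 - (k - 2 * a - 1)) := by
  have e : k - 1 - (k - 2 * a - 1) = 2 * a := by omega
  rw [e, mul_comm]

/-- **THE LOCUS, EVERY VERTEX TYPE, BY INDUCTION ON `k`:** `K₄⁻`-free, `4 ≤ a`, `2a + 2 ≤ k`, `m = a (k − a)`, not
`a`-bipartite, `Σ_v d(v)² + 2a (k − 2a − 1) = m k` ⇒ `D ⊆ K(A, Aᶜ)` with `|A| = a + 1` and the missing cross pairs a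
star. -/
theorem diag_second_locus_aux (a : ℕ) (ha : 4 ≤ a) (n : ℕ) :
    ∀ (W : Type u) [Fintype W] [DecidableEq W] (D : SimpleGraph W) [DecidableRel D.Adj], Fintype.card W = n →
      K4mFree D → 2 * a + 2 ≤ Fintype.card W → D.edgeFinset.card = a * (Fintype.card W - a) →
      ¬ (∃ A : Finset W, A.card = a ∧ BipSub D A) →
      ∑ v, deg D v * deg D v + 2 * a * (Fintype.card W - 2 * a - 1) = D.edgeFinset.card * Fintype.card W →
      ∃ (A : Finset W) (v : W), A.card = a + 1 ∧ BipSub D A ∧ MissingStar D A v := by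
  refine Nat.strong_induction_on n ?_
  intro n ih W _ _ D _ hn hK hk hm hnb heq
  -- `D` is `(a + 1)`-bipartite
  have hA : ∃ A : Finset W, A.card = a + 1 ∧ BipSub D A := by
    -- (A) no vertex at the cap
    by_cases hx : ∃ x, deg D x + a = Fintype.card W
    · obtain ⟨x, hx⟩ := hx
      exact absurd (diag_cap_gen D hK a ha (by omega) hm x hx) hnb
    push Not at hx
    have hcap : ∀ v, deg D v + a ≤ Fintype.card W := fun v =>
      deg_add_le_card_of_dense D hK a (by omega) (by omega)
        (cap_arith a (Fintype.card W) D.edgeFinset.card 0 (by omega) (by omega)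
          (diag_cap_arith a (Fintype.card W) D.edgeFinset.card (by omega) hm)) v
    have hcap' : ∀ v, deg D v + a + 1 ≤ Fintype.card W := fun v => by
      have h1 := hcap v
      have h2 := hx v
      omega
    -- (B) the convexity is strict
    by_cases hdeg : ∀ v, a + 1 ≤ deg D v
    · exfalso
      have h := diag_convex_strict D a hk hm hcap' hdeg
      omega
    push Not at hdeg
    obtain ⟨z, hz⟩ := hdeg
    rcases Nat.lt_or_ge (deg D z) a with hz1 | hz2
    · -- (C) the cross-row case
      exact diag_cross_eq D hK a ha hk hm hcap' z (by omega) heq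
    · -- (D) the within-row case with the induction hypothesis
      have hza : deg D z = a := by omega
      have hcard' := card_del z
      have hedges' := card_edges_del D z
      have hm' : (del D z).edgeFinset.card = a * (Fintype.card {v : W // v ≠ z} - a) := by
        have e : Fintype.card {v : W // v ≠ z} = Fintype.card W - 1 := by omega
        rw [e]
        exact (diag_within_edges a (Fintype.card W) D.edgeFinset.card (del D z).edgeFinset.card hk
          (by rw [← hza]; exact hedges') hm).1
      exact diag_within_eq D hK a ha hk hm hcap' z hza hnb heq (fun h1 h2 h3 =>
        ih (Fintype.card {v : W // v ≠ z}) (by omega) {v : W // v ≠ z} (del D z) rfl (k4mFree_del D hK z) h1 hm'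
          h2 h3)
  -- the first-order equality on the other bipartition: the missing pairs form a star
  obtain ⟨A, hAcard, hA⟩ := hA
  have hmA := below_bip_edges a 0 (Fintype.card W) D.edgeFinset.card hk (by rw [add_zero]; exact hm)
  rw [add_zero] at hmA
  have heq' : ∑ v, deg D v * deg D v + (Fintype.card W - 2 * a - 1) *
      (Fintype.card W - 1 - (Fintype.card W - 2 * a - 1)) = D.edgeFinset.card * Fintype.card W := by
    rw [← diag_other_term a (Fintype.card W) hk]
    exact heq
  obtain ⟨v, hv⟩ := exists_missingStar_of_closed_form_eq D A hA (a + 1) (Fintype.card W - 2 * a - 1) hAcard hmA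
    (by omega) heq'
  exact ⟨A, v, hAcard, hA, hv⟩

/-- **THE EQUALITY LOCUS OF THE DIAGONAL AT SECOND ORDER, EVERY ROW `a ≥ 4`:** `K₄⁻`-free, `2a + 2 ≤ k`,
`m = a (k − a)`, not a spanning subgraph of any `K(A, Aᶜ)` with `|A| = a`, `Σ_v d(v)² + 2a (k − 2a − 1) = m k` ⇒ `D` is
a spanning subgraph of some `K(A, Aᶜ)` with `|A| = a + 1` whose missing cross pairs form a star —
`K_{a+1,k−a−1}` minus a `(k − 2a − 1)`-star. -/
theorem diag_second_locus (D : SimpleGraph V) [DecidableRel D.Adj] (hK : K4mFree D) (a : ℕ) (ha : 4 ≤ a)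
    (hk : 2 * a + 2 ≤ Fintype.card V) (hm : D.edgeFinset.card = a * (Fintype.card V - a))
    (hnb : ¬ ∃ A : Finset V, A.card = a ∧ BipSub D A)
    (heq : ∑ v, deg D v * deg D v + 2 * a * (Fintype.card V - 2 * a - 1) = D.edgeFinset.card * Fintype.card V) :
    ∃ (A : Finset V) (v : V), A.card = a + 1 ∧ BipSub D A ∧ MissingStar D A v :=
  diag_second_locus_aux a ha (Fintype.card V) V D rfl hK hk hm hnb heq

/-- **THE SECOND-BEST MAXIMISERS ON THE DIAGONAL, `Fin k`:** for `4 ≤ a`, `2a + 2 ≤ k`, a `K₄⁻`-free graph on `Fin k`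
with `a (k − a)` edges that is not extremal attains `Σ_v d(v)² + 2a (k − 2a − 1) = m k` iff it is `K_{a+1,k−a−1}`
minus a `(k − 2a − 1)`-star (`∃ A v`, `|A| = a + 1`, `BipSub D A`, `MissingStar D A v`). -/
theorem diag_second_best_maximisers (k a : ℕ) (ha : 4 ≤ a) (hk : 2 * a + 2 ≤ k) (D : SimpleGraph (Fin k))
    [DecidableRel D.Adj] (hK : K4mFree D) (hm : D.edgeFinset.card = a * (k - a))
    (hne : ∑ v, deg D v * deg D v ≠ D.edgeFinset.card * k) :
    ∑ v, deg D v * deg D v + 2 * a * (k - 2 * a - 1) = D.edgeFinset.card * k ↔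
      ∃ (A : Finset (Fin k)) (v : Fin k), A.card = a + 1 ∧ BipSub D A ∧ MissingStar D A v := by
  have hcard : Fintype.card (Fin k) = k := Fintype.card_fin k
  constructor
  · intro heq
    have hnb : ¬ ∃ A : Finset (Fin k), A.card = a ∧ BipSub D A := by
      rintro ⟨A, hAcard, hA⟩
      apply hne
      have := sum_deg_sq_eq_of_bipSub_full D A a hAcard hA (by rw [hcard]; exact hm)
        (Fintype.card_pos_iff.mp (by omega))
      rw [hcard] at this
      exact this
    have := diag_second_locus D hK a ha (by omega) (by rw [hcard]; exact hm) hnb (by rw [hcard]; exact heq)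
    exact this
  · rintro ⟨A, v, hAcard, hA, hv⟩
    have hmA := below_bip_edges a 0 k D.edgeFinset.card hk (by rw [add_zero]; exact hm)
    rw [add_zero] at hmA
    have h := closed_form_eq_of_missingStar D A hA hv (a + 1) (k - 2 * a - 1) hAcard (by rw [hcard]; exact hmA)
      (by rw [hcard]; omega)
    rw [hcard, ← diag_other_term a k hk] at h
    exact h

end C047

end TriangleCap

end PercRepro
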